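import Mathlib
import HarnessLib
import Summits.NavierStokesRegularity.NavierStokesRegularity.Theorems.SubOnsagerCeilingKPChainOccupation

/-!
# The ν-uniform LIGHT CONE of the positive Katz–Pavlović chain: shells ahead of a capped shell are
# doubly-exponentially dark before one turnover time
# (helper file for the crux `SubOnsagerCeiling.ForwardTailCeilingKP`, stmt-NavierStokesRegularity-27057, `--supports`)

Chain format VERBATIM that of `Theorems/SubOnsagerCeilingKPChainOccupation.lean` (p837964), `…KPChainPeak.lean` and the LEAD's
chain rungs: an honest solution `Z_k : [0,s] → ℝ` (`k ≥ -1`) of the NS-scaled viscous chain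
`Ż_k = c₀ (b^{5(k-1)/2} Z_{k-1}² − b^{5k/2} Z_k Z_{k+1}) − ν b^{2k} Z_k` (`c₀ ≥ 0`, `ν ≥ 0`, `b > 0`) from the one-shell datum
`Z_k(0) = x₀ 1_{k=0}`, continuous on `[0,s]`, non-negative on the shells `k ≥ 1`.  Write `Λ := b^{5/2}`.

The registered stubs `stub_primaryGradedLargeRatio` / `stub_primaryGradedSmallRatio` of the LEAD skeleton
`Cruxes/ForwardTailCeilingKP/Lines/kp_shell_barrier.lean` contain the ν-uniform `θ > 1/2` shell barrier of this chain at every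
ratio `b ∈ (1, 2]`; the repair census of the hands (items (A′1)/(A′2): adiabatic lattice shock for `b ≤ b_d ≈ 1.035`, pushed
Dombre–Gilson front above) is an analysis of the chain's FRONT.  This file lands the first a-priori statement about the LEADING
EDGE of that front that holds at EVERY ratio, uniformly in `ν`, from a cap on ONE shell and nothing else:

* `next_le_of_sq_le_pow` — one causality step: if `Z_m(τ)² ≤ (C τ^n)²` on `[0,T]` then
  `Z_{m+1}(t) ≤ c₀ b^{5m/2} C² t^{2n+1}` on `[0,T]` (`next_le_occupation` + `∫₀ᵗ τ^{2n} = t^{2n+1}/(2n+1) ≤ t^{2n+1}`);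
* **`lightCone_sq`** — THE LIGHT CONE: if `Z_k(τ)² ≤ M²` on `[0,T]` (`M ≥ 0`), then for EVERY `j ≥ 0` and `t ∈ [0,T]`
  `Z_{k+j}(t)² ≤ ( M · b^{−5j/2} · (K t)^{2^j − 1} )²`, `K := c₀ b^{5(k+1)/2} M = c₀ Λ^{k+1} M`
  (induction on `j`; the exponents close exactly: `c₀ b^{5(k+j)/2} (M b^{-5j/2})² K^{2n} = M b^{-5(j+1)/2} K^{2n+1}`);
* `lightCone_le` — for `j ≥ 1` the shells are non-negative, so `0 ≤ Z_{k+j}(t) ≤ M b^{−5j/2} (K t)^{2^j − 1}`;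
* `lightCone_energy_le` — BEFORE ONE TURNOVER TIME (`K T ≤ 1`): `½ Z_{k+j}(t)² ≤ b^{−5j} (K t)² · ½ M²` for every `j ≥ 1` —
  the shell `j` steps ahead holds at most the fraction `b^{-5j}(Kt)²` of the cap energy, and the profile ahead of a capped
  shell decays in `j` at least like the DOUBLE exponential `(Kt)^{2^j}` on top of the geometric factor `Λ^{-j}`.

Reading (memo LIGHT-CONE-leafhand4-g14.md on the item).  `1/K = 1/(c₀ Λ^{k+1} M)` is the Λ-scaled turnover time of the cap level
`M` at shell `k`; within it NOTHING ahead of shell `k` can light up, whatever `ν`: the precursor of the chain's front is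
super-exponentially thin (no linear spreading ahead of the front ⇒ the front is PUSHED, selected by the nonlinear bulk — the
lattice form of the hands' DG/lattice-shock reading), the front needs at least one turnover time per shell (so the passage
times `≳ 1/(c₀ Λ^{k+1} M_k)` are summable only if the peaks `M_k` decay slower than `Λ^{-k}`), and a barrier argument at
shell `k` may treat the shells `≥ k+2` as dark during the first turnover time with an explicit doubly-exponential error.
HONEST FRAMING: statements about a MODEL lattice ODE (route SubOnsagerCeiling, rung TL-M2Break); elementary causality
bookkeeping, not a barrier; no stub, crux or summit is proved here and nothing in this file bears on Navier–Stokes regularity.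
[cite: Tao2016AveragedNS, §4 (4.13)] [cite: BarbatoMorandinRomito2011, §2 (the chain)]
-/

noncomputable section

-- the sub-problem namespace `NavierStokesRegularity.NavierStokesRegularity` is the tree's layout (D-0017)
set_option linter.dupNamespace false

namespace Summit.NavierStokesRegularity.NavierStokesRegularity.Theorems.KPChainLightCone

open Set MeasureTheory intervalIntegral
open Summit.NavierStokesRegularity.NavierStokesRegularity.Theorems.KPChainOccupation

/-- The even-power integral bound: if `f(τ)² ≤ (C τ^n)²` on `[0,t]` (`t ≥ 0`, `f` continuous on `[0,t]`), then
`∫₀ᵗ f² ≤ C² t^{2n+1}` (the exact value of the majorant is `C² t^{2n+1}/(2n+1)`). [this file] -/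
theorem integral_sq_le_of_sq_le_pow {f : ℝ → ℝ} {t C : ℝ} {n : ℕ} (ht : 0 ≤ t)
    (hf : ContinuousOn f (Icc 0 t)) (hle : ∀ τ ∈ Icc 0 t, f τ ^ 2 ≤ (C * τ ^ n) ^ 2) :
    (∫ τ in (0 : ℝ)..t, f τ ^ 2) ≤ C ^ 2 * t ^ (2 * n + 1) := by
  have hfi : IntervalIntegrable (fun τ => f τ ^ 2) volume 0 t :=
    (hf.pow 2).intervalIntegrable_of_Icc ht
  have hgi : IntervalIntegrable (fun τ => (C * τ ^ n) ^ 2) volume 0 t :=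
    ((continuous_const.mul (continuous_pow n)).pow 2).intervalIntegrable _ _
  have hmono : (∫ τ in (0 : ℝ)..t, f τ ^ 2) ≤ ∫ τ in (0 : ℝ)..t, (C * τ ^ n) ^ 2 :=
    intervalIntegral.integral_mono_on ht hfi hgi hle
  have hval : (∫ τ in (0 : ℝ)..t, (C * τ ^ n) ^ 2) = C ^ 2 * (t ^ (2 * n + 1) / (2 * n + 1)) := by
    have h1 : (∫ τ in (0 : ℝ)..t, (C * τ ^ n) ^ 2) = ∫ τ in (0 : ℝ)..t, C ^ 2 * τ ^ (2 * n) := by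
      congr 1; ext τ; ring
    rw [h1, intervalIntegral.integral_const_mul, integral_pow]
    congr 1
    rw [zero_pow (by omega), sub_zero]
    push_cast
    ring
  have hpow : 0 ≤ t ^ (2 * n + 1) := pow_nonneg ht _
  have hdiv : t ^ (2 * n + 1) / (2 * n + 1) ≤ t ^ (2 * n + 1) := by
    apply div_le_self hpow
    have : (0 : ℝ) ≤ (n : ℝ) := Nat.cast_nonneg n
    linarith
  calc (∫ τ in (0 : ℝ)..t, f τ ^ 2) ≤ C ^ 2 * (t ^ (2 * n + 1) / (2 * n + 1)) := hmono.trans hval.le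
    _ ≤ C ^ 2 * t ^ (2 * n + 1) := mul_le_mul_of_nonneg_left hdiv (sq_nonneg C)

/-- **One causality step** (non-negative chain, `c₀ ≥ 0`, `ν ≥ 0`, `b > 0`): if `Z_m(τ)² ≤ (C τ^n)²` on `[0,T]`, then
`Z_{m+1}(t) ≤ c₀ b^{5m/2} C² t^{2n+1}` for every `t ∈ [0,T]` — uniformly in `ν`. [this file] -/
theorem next_le_of_sq_le_pow {b c₀ ν s x₀ : ℝ} (hb : 0 < b) (hc₀ : 0 ≤ c₀) (hν : 0 ≤ ν) {Z : ℤ → ℝ → ℝ}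
    (hdat : ∀ k : ℤ, Z k 0 = if k = 0 then x₀ else 0)
    (hcont : ∀ k : ℕ, ContinuousOn (Z k) (Icc 0 s))
    (hode : ∀ k : ℕ, ∀ t ∈ Icc 0 s, HasDerivWithinAt (Z k)
      (c₀ * (b ^ ((5 : ℝ) * ((k : ℝ) - 1) / 2) * Z ((k : ℤ) - 1) t ^ 2 -
          b ^ ((5 : ℝ) * (k : ℝ) / 2) * (Z k t * Z ((k : ℤ) + 1) t)) -
        ν * b ^ ((2 : ℝ) * (k : ℝ)) * Z k t) (Icc 0 s) t)
    (hnn : ∀ t ∈ Icc 0 s, ∀ k : ℕ, 1 ≤ k → 0 ≤ Z k t)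
    (m : ℕ) {T : ℝ} (hT : T ∈ Icc 0 s) {C : ℝ} {n : ℕ}
    (hcap : ∀ τ ∈ Icc 0 T, Z (m : ℤ) τ ^ 2 ≤ (C * τ ^ n) ^ 2) :
    ∀ t ∈ Icc 0 T, Z ((m : ℤ) + 1) t ≤ c₀ * b ^ ((5 : ℝ) * (m : ℝ) / 2) * (C ^ 2 * t ^ (2 * n + 1)) := by
  intro t ht
  have hts : t ∈ Icc 0 s := ⟨ht.1, ht.2.trans hT.2⟩
  have h1 := next_le_occupation hb hc₀ hν hdat hcont hode hnn m hts
  have hf : ContinuousOn (Z (m : ℤ)) (Icc 0 t) := (hcont m).mono (Icc_subset_Icc le_rfl hts.2)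
  have hI : (∫ τ in (0 : ℝ)..t, Z (m : ℤ) τ ^ 2) ≤ C ^ 2 * t ^ (2 * n + 1) :=
    integral_sq_le_of_sq_le_pow ht.1 hf fun τ hτ => hcap τ ⟨hτ.1, hτ.2.trans ht.2⟩
  have hB : 0 ≤ c₀ * b ^ ((5 : ℝ) * (m : ℝ) / 2) := mul_nonneg hc₀ (Real.rpow_pos_of_pos hb _).le
  exact h1.trans (mul_le_mul_of_nonneg_left hI hB)

/-- The double-exponential bookkeeping `2^{j+1} − 1 = 2 (2^j − 1) + 1` (natural subtraction is harmless since `2^j ≥ 1`).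
[this file] -/
theorem two_pow_succ_sub_one (j : ℕ) : 2 ^ (j + 1) - 1 = 2 * (2 ^ j - 1) + 1 := by
  have h : 1 ≤ 2 ^ j := Nat.one_le_two_pow
  rw [pow_succ]
  omega

/-- **THE LIGHT CONE of the positive viscous Katz–Pavlović chain** (every `b > 0`, `c₀ ≥ 0`, `ν ≥ 0`, every window): if the
shell `k` is capped, `Z_k(τ)² ≤ M²` on `[0,T]` (`M ≥ 0`, `T ≤ s`), then for every `j ≥ 0` and every `t ∈ [0,T]`
`Z_{k+j}(t)² ≤ ( M · b^{-5j/2} · (K t)^{2^j − 1} )²` with `K = c₀ b^{5(k+1)/2} M` — the shells ahead of a capped shell are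
dark up to a DOUBLY-exponentially small precursor before the turnover time `1/K`, uniformly in the viscosity. [this file] -/
theorem lightCone_sq {b c₀ ν s x₀ : ℝ} (hb : 0 < b) (hc₀ : 0 ≤ c₀) (hν : 0 ≤ ν) {Z : ℤ → ℝ → ℝ}
    (hdat : ∀ k : ℤ, Z k 0 = if k = 0 then x₀ else 0)
    (hcont : ∀ k : ℕ, ContinuousOn (Z k) (Icc 0 s))
    (hode : ∀ k : ℕ, ∀ t ∈ Icc 0 s, HasDerivWithinAt (Z k)
      (c₀ * (b ^ ((5 : ℝ) * ((k : ℝ) - 1) / 2) * Z ((k : ℤ) - 1) t ^ 2 -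
          b ^ ((5 : ℝ) * (k : ℝ) / 2) * (Z k t * Z ((k : ℤ) + 1) t)) -
        ν * b ^ ((2 : ℝ) * (k : ℝ)) * Z k t) (Icc 0 s) t)
    (hnn : ∀ t ∈ Icc 0 s, ∀ k : ℕ, 1 ≤ k → 0 ≤ Z k t)
    (k : ℕ) {M T : ℝ} (hM : 0 ≤ M) (hT : T ∈ Icc 0 s)
    (hcap : ∀ τ ∈ Icc 0 T, Z (k : ℤ) τ ^ 2 ≤ M ^ 2) :
    ∀ j : ℕ, ∀ t ∈ Icc 0 T, Z ((k + j : ℕ) : ℤ) t ^ 2 ≤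
      (M * b ^ (-((5 : ℝ) * (j : ℝ) / 2)) *
        (c₀ * b ^ ((5 : ℝ) * ((k : ℝ) + 1) / 2) * M * t) ^ (2 ^ j - 1)) ^ 2 := by
  intro j
  induction j with
  | zero =>
    intro t ht
    have h0 : b ^ (-((5 : ℝ) * ((0 : ℕ) : ℝ) / 2)) = 1 := by
      rw [Nat.cast_zero, mul_zero, zero_div, neg_zero, Real.rpow_zero]
    rw [h0]
    simpa using hcap t ht
  | succ j ih =>
    intro t ht
    -- the shell `k + j` obeys the inductive bound, rewritten as `(C τ^n)²`
    set n : ℕ := 2 ^ j - 1 with hn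
    set Bj : ℝ := b ^ (-((5 : ℝ) * (j : ℝ) / 2)) with hBj
    set K : ℝ := c₀ * b ^ ((5 : ℝ) * ((k : ℝ) + 1) / 2) * M with hK
    have hcapj : ∀ τ ∈ Icc 0 T, Z ((k + j : ℕ) : ℤ) τ ^ 2 ≤ ((M * Bj * K ^ n) * τ ^ n) ^ 2 := by
      intro τ hτ
      have := ih τ hτ
      calc Z ((k + j : ℕ) : ℤ) τ ^ 2 ≤ (M * Bj * (K * τ) ^ n) ^ 2 := this
        _ = ((M * Bj * K ^ n) * τ ^ n) ^ 2 := by ring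
    -- one causality step
    have hstep := next_le_of_sq_le_pow hb hc₀ hν hdat hcont hode hnn (k + j) hT hcapj t ht
    have hidx : (((k + (j + 1) : ℕ)) : ℤ) = ((k + j : ℕ) : ℤ) + 1 := by push_cast; ring
    rw [hidx]
    -- the exponents close exactly
    have hexp : b ^ ((5 : ℝ) * (((k + j : ℕ)) : ℝ) / 2) * (Bj * Bj) =
        b ^ (-((5 : ℝ) * (((j + 1 : ℕ)) : ℝ) / 2)) * b ^ ((5 : ℝ) * ((k : ℝ) + 1) / 2) := by
      rw [hBj, ← Real.rpow_add hb, ← Real.rpow_add hb, ← Real.rpow_add hb]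
      congr 1
      push_cast
      ring
    have hval : c₀ * b ^ ((5 : ℝ) * (((k + j : ℕ)) : ℝ) / 2) * ((M * Bj * K ^ n) ^ 2 * t ^ (2 * n + 1)) =
        M * b ^ (-((5 : ℝ) * (((j + 1 : ℕ)) : ℝ) / 2)) * (K * t) ^ (2 * n + 1) := by
      rw [hK]
      linear_combination (c₀ * M ^ 2 * (c₀ * b ^ ((5 : ℝ) * ((k : ℝ) + 1) / 2) * M) ^ (2 * n) *
        t ^ (2 * n + 1)) * hexp
    have hle : Z (((k + j : ℕ) : ℤ) + 1) t ≤
        M * b ^ (-((5 : ℝ) * (((j + 1 : ℕ)) : ℝ) / 2)) * (K * t) ^ (2 * n + 1) := by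
      rw [← hval]; exact hstep
    -- non-negativity of the shell `k + j + 1 ≥ 1` and of the majorant, then square
    have hz : 0 ≤ Z (((k + j : ℕ) : ℤ) + 1) t := by
      have h := hnn t ⟨ht.1, ht.2.trans hT.2⟩ (k + j + 1) (by omega)
      have hidx' : (((k + j + 1 : ℕ)) : ℤ) = ((k + j : ℕ) : ℤ) + 1 := by push_cast; ring
      rwa [hidx'] at h
    have hKt : 0 ≤ K * t := by
      rw [hK]
      exact mul_nonneg (mul_nonneg (mul_nonneg hc₀ (Real.rpow_pos_of_pos hb _).le) hM) ht.1
    have hmaj : 0 ≤ M * b ^ (-((5 : ℝ) * (((j + 1 : ℕ)) : ℝ) / 2)) * (K * t) ^ (2 * n + 1) :=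
      mul_nonneg (mul_nonneg hM (Real.rpow_pos_of_pos hb _).le) (pow_nonneg hKt _)
    rw [two_pow_succ_sub_one, ← hn]
    exact pow_le_pow_left₀ hz hle 2

/-- **Light cone, amplitude form**: under the hypotheses of `lightCone_sq`, for every `j ≥ 1` and `t ∈ [0,T]`
`0 ≤ Z_{k+j}(t) ≤ M · b^{-5j/2} · (K t)^{2^j − 1}`, `K = c₀ b^{5(k+1)/2} M`. [this file] -/
theorem lightCone_le {b c₀ ν s x₀ : ℝ} (hb : 0 < b) (hc₀ : 0 ≤ c₀) (hν : 0 ≤ ν) {Z : ℤ → ℝ → ℝ}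
    (hdat : ∀ k : ℤ, Z k 0 = if k = 0 then x₀ else 0)
    (hcont : ∀ k : ℕ, ContinuousOn (Z k) (Icc 0 s))
    (hode : ∀ k : ℕ, ∀ t ∈ Icc 0 s, HasDerivWithinAt (Z k)
      (c₀ * (b ^ ((5 : ℝ) * ((k : ℝ) - 1) / 2) * Z ((k : ℤ) - 1) t ^ 2 -
          b ^ ((5 : ℝ) * (k : ℝ) / 2) * (Z k t * Z ((k : ℤ) + 1) t)) -
        ν * b ^ ((2 : ℝ) * (k : ℝ)) * Z k t) (Icc 0 s) t)
    (hnn : ∀ t ∈ Icc 0 s, ∀ k : ℕ, 1 ≤ k → 0 ≤ Z k t)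
    (k : ℕ) {M T : ℝ} (hM : 0 ≤ M) (hT : T ∈ Icc 0 s)
    (hcap : ∀ τ ∈ Icc 0 T, Z (k : ℤ) τ ^ 2 ≤ M ^ 2) {j : ℕ} (hj : 1 ≤ j) :
    ∀ t ∈ Icc 0 T, 0 ≤ Z ((k + j : ℕ) : ℤ) t ∧ Z ((k + j : ℕ) : ℤ) t ≤
      M * b ^ (-((5 : ℝ) * (j : ℝ) / 2)) *
        (c₀ * b ^ ((5 : ℝ) * ((k : ℝ) + 1) / 2) * M * t) ^ (2 ^ j - 1) := by
  intro t ht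
  have hsq := lightCone_sq hb hc₀ hν hdat hcont hode hnn k hM hT hcap j t ht
  have hz : 0 ≤ Z ((k + j : ℕ) : ℤ) t := hnn t ⟨ht.1, ht.2.trans hT.2⟩ (k + j) (by omega)
  have hKt : 0 ≤ c₀ * b ^ ((5 : ℝ) * ((k : ℝ) + 1) / 2) * M * t :=
    mul_nonneg (mul_nonneg (mul_nonneg hc₀ (Real.rpow_pos_of_pos hb _).le) hM) ht.1
  have hmaj : 0 ≤ M * b ^ (-((5 : ℝ) * (j : ℝ) / 2)) *
      (c₀ * b ^ ((5 : ℝ) * ((k : ℝ) + 1) / 2) * M * t) ^ (2 ^ j - 1) :=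
    mul_nonneg (mul_nonneg hM (Real.rpow_pos_of_pos hb _).le) (pow_nonneg hKt _)
  exact ⟨hz, le_of_pow_le_pow_left₀ two_ne_zero hmaj hsq⟩

/-- **Light cone, energy form before one turnover time**: under the hypotheses of `lightCone_sq`, if moreover
`K T ≤ 1` (`K = c₀ b^{5(k+1)/2} M`: the window is shorter than the Λ-scaled turnover time of the cap level at shell `k`),
then for every `j ≥ 1` and `t ∈ [0,T]`: `½ Z_{k+j}(t)² ≤ (b^{-5j/2})² (K t)² · ½ M²` — the shell `j` steps ahead holds at
most the fraction `b^{-5j} (Kt)²` of the cap energy, uniformly in `ν`. [this file] -/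
theorem lightCone_energy_le {b c₀ ν s x₀ : ℝ} (hb : 0 < b) (hc₀ : 0 ≤ c₀) (hν : 0 ≤ ν) {Z : ℤ → ℝ → ℝ}
    (hdat : ∀ k : ℤ, Z k 0 = if k = 0 then x₀ else 0)
    (hcont : ∀ k : ℕ, ContinuousOn (Z k) (Icc 0 s))
    (hode : ∀ k : ℕ, ∀ t ∈ Icc 0 s, HasDerivWithinAt (Z k)
      (c₀ * (b ^ ((5 : ℝ) * ((k : ℝ) - 1) / 2) * Z ((k : ℤ) - 1) t ^ 2 -
          b ^ ((5 : ℝ) * (k : ℝ) / 2) * (Z k t * Z ((k : ℤ) + 1) t)) -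
        ν * b ^ ((2 : ℝ) * (k : ℝ)) * Z k t) (Icc 0 s) t)
    (hnn : ∀ t ∈ Icc 0 s, ∀ k : ℕ, 1 ≤ k → 0 ≤ Z k t)
    (k : ℕ) {M T : ℝ} (hM : 0 ≤ M) (hT : T ∈ Icc 0 s)
    (hcap : ∀ τ ∈ Icc 0 T, Z (k : ℤ) τ ^ 2 ≤ M ^ 2)
    (hturn : c₀ * b ^ ((5 : ℝ) * ((k : ℝ) + 1) / 2) * M * T ≤ 1) {j : ℕ} (hj : 1 ≤ j) :
    ∀ t ∈ Icc 0 T, (1 / 2 : ℝ) * Z ((k + j : ℕ) : ℤ) t ^ 2 ≤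
      (b ^ (-((5 : ℝ) * (j : ℝ) / 2))) ^ 2 * (c₀ * b ^ ((5 : ℝ) * ((k : ℝ) + 1) / 2) * M * t) ^ 2 *
        ((1 / 2 : ℝ) * M ^ 2) := by
  intro t ht
  have hsq := lightCone_sq hb hc₀ hν hdat hcont hode hnn k hM hT hcap j t ht
  set K : ℝ := c₀ * b ^ ((5 : ℝ) * ((k : ℝ) + 1) / 2) * M with hK
  have hK0 : 0 ≤ K := by rw [hK]; exact mul_nonneg (mul_nonneg hc₀ (Real.rpow_pos_of_pos hb _).le) hM
  have hKt0 : 0 ≤ K * t := mul_nonneg hK0 ht.1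
  have hKt1 : K * t ≤ 1 := (mul_le_mul_of_nonneg_left ht.2 hK0).trans hturn
  have hn : 1 ≤ 2 ^ j - 1 := by
    have h2 : 2 ≤ 2 ^ j := by
      calc 2 = 2 ^ 1 := by norm_num
        _ ≤ 2 ^ j := Nat.pow_le_pow_right (by norm_num) hj
    omega
  have hpow : (K * t) ^ (2 ^ j - 1) ≤ (K * t) ^ 1 := pow_le_pow_of_le_one hKt0 hKt1 hn
  rw [pow_one] at hpow
  have hpow0 : 0 ≤ (K * t) ^ (2 ^ j - 1) := pow_nonneg hKt0 _
  have hB : 0 ≤ b ^ (-((5 : ℝ) * (j : ℝ) / 2)) := (Real.rpow_pos_of_pos hb _).le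
  have hsq2 : ((K * t) ^ (2 ^ j - 1)) ^ 2 ≤ (K * t) ^ 2 := pow_le_pow_left₀ hpow0 hpow 2
  have hMB : 0 ≤ (M * b ^ (-((5 : ℝ) * (j : ℝ) / 2))) ^ 2 := sq_nonneg _
  calc (1 / 2 : ℝ) * Z ((k + j : ℕ) : ℤ) t ^ 2
      ≤ (1 / 2 : ℝ) * (M * b ^ (-((5 : ℝ) * (j : ℝ) / 2)) * (K * t) ^ (2 ^ j - 1)) ^ 2 :=
        mul_le_mul_of_nonneg_left hsq (by norm_num)
    _ = (1 / 2 : ℝ) * ((M * b ^ (-((5 : ℝ) * (j : ℝ) / 2))) ^ 2 * ((K * t) ^ (2 ^ j - 1)) ^ 2) := by ring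
    _ ≤ (1 / 2 : ℝ) * ((M * b ^ (-((5 : ℝ) * (j : ℝ) / 2))) ^ 2 * (K * t) ^ 2) :=
        mul_le_mul_of_nonneg_left (mul_le_mul_of_nonneg_left hsq2 hMB) (by norm_num)
    _ = (b ^ (-((5 : ℝ) * (j : ℝ) / 2))) ^ 2 * (K * t) ^ 2 * ((1 / 2 : ℝ) * M ^ 2) := by ring

/-- **Light cone, tail form before one turnover time** (`b > 1`): under the hypotheses of `lightCone_energy_le`, for every
`J` and `t ∈ [0,T]` the energy of the shells `k+1, …, k+J` is at most `(K t)² · r/(1−r) · ½M²` with `r = b^{-5}`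
(`r/(1−r) = 1/(b⁵−1)`): before one turnover time the WHOLE tail beyond a capped shell holds at most the fraction
`(Kt)²/(b⁵−1)` of the cap energy, uniformly in `ν` and in the length `J` of the tail. [this file] -/
theorem lightCone_tail_le {b c₀ ν s x₀ : ℝ} (hb : 1 < b) (hc₀ : 0 ≤ c₀) (hν : 0 ≤ ν) {Z : ℤ → ℝ → ℝ}
    (hdat : ∀ k : ℤ, Z k 0 = if k = 0 then x₀ else 0)
    (hcont : ∀ k : ℕ, ContinuousOn (Z k) (Icc 0 s))
    (hode : ∀ k : ℕ, ∀ t ∈ Icc 0 s, HasDerivWithinAt (Z k)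
      (c₀ * (b ^ ((5 : ℝ) * ((k : ℝ) - 1) / 2) * Z ((k : ℤ) - 1) t ^ 2 -
          b ^ ((5 : ℝ) * (k : ℝ) / 2) * (Z k t * Z ((k : ℤ) + 1) t)) -
        ν * b ^ ((2 : ℝ) * (k : ℝ)) * Z k t) (Icc 0 s) t)
    (hnn : ∀ t ∈ Icc 0 s, ∀ k : ℕ, 1 ≤ k → 0 ≤ Z k t)
    (k : ℕ) {M T : ℝ} (hM : 0 ≤ M) (hT : T ∈ Icc 0 s)
    (hcap : ∀ τ ∈ Icc 0 T, Z (k : ℤ) τ ^ 2 ≤ M ^ 2)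
    (hturn : c₀ * b ^ ((5 : ℝ) * ((k : ℝ) + 1) / 2) * M * T ≤ 1) (J : ℕ) :
    ∀ t ∈ Icc 0 T, ∑ j ∈ Finset.Icc 1 J, (1 / 2 : ℝ) * Z ((k + j : ℕ) : ℤ) t ^ 2 ≤
      (c₀ * b ^ ((5 : ℝ) * ((k : ℝ) + 1) / 2) * M * t) ^ 2 *
        (b ^ (-(5 : ℝ)) / (1 - b ^ (-(5 : ℝ)))) * ((1 / 2 : ℝ) * M ^ 2) := by
  intro t ht
  have hb0 : 0 < b := by linarith
  set K : ℝ := c₀ * b ^ ((5 : ℝ) * ((k : ℝ) + 1) / 2) * M with hK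
  set r : ℝ := b ^ (-(5 : ℝ)) with hr
  have hr0 : 0 < r := Real.rpow_pos_of_pos hb0 _
  have hr1 : r < 1 := Real.rpow_lt_one_of_one_lt_of_neg hb (by norm_num)
  -- each shell `k + j`, `j ≥ 1`, holds at most `r^j (Kt)² ½M²`
  have hshell : ∀ j ∈ Finset.Icc 1 J, (1 / 2 : ℝ) * Z ((k + j : ℕ) : ℤ) t ^ 2 ≤
      r ^ j * ((K * t) ^ 2 * ((1 / 2 : ℝ) * M ^ 2)) := by
    intro j hj
    have hj1 : 1 ≤ j := (Finset.mem_Icc.mp hj).1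
    have h := lightCone_energy_le hb0 hc₀ hν hdat hcont hode hnn k hM hT hcap hturn hj1 t ht
    have hrj : (b ^ (-((5 : ℝ) * (j : ℝ) / 2))) ^ 2 = r ^ j := by
      rw [hr, sq, ← Real.rpow_add hb0, ← Real.rpow_mul_natCast hb0.le]
      congr 1
      ring
    calc (1 / 2 : ℝ) * Z ((k + j : ℕ) : ℤ) t ^ 2
        ≤ (b ^ (-((5 : ℝ) * (j : ℝ) / 2))) ^ 2 * (K * t) ^ 2 * ((1 / 2 : ℝ) * M ^ 2) := h
      _ = r ^ j * ((K * t) ^ 2 * ((1 / 2 : ℝ) * M ^ 2)) := by rw [hrj]; ring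
  have hgeom : ∑ j ∈ Finset.Icc 1 J, r ^ j ≤ r ^ 1 / (1 - r) := by
    rw [← Finset.Ico_add_one_right_eq_Icc]
    exact geom_sum_Ico_le_of_lt_one hr0.le hr1
  have hE : 0 ≤ (K * t) ^ 2 * ((1 / 2 : ℝ) * M ^ 2) := by positivity
  calc ∑ j ∈ Finset.Icc 1 J, (1 / 2 : ℝ) * Z ((k + j : ℕ) : ℤ) t ^ 2
      ≤ ∑ j ∈ Finset.Icc 1 J, r ^ j * ((K * t) ^ 2 * ((1 / 2 : ℝ) * M ^ 2)) := Finset.sum_le_sum hshell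
    _ = (∑ j ∈ Finset.Icc 1 J, r ^ j) * ((K * t) ^ 2 * ((1 / 2 : ℝ) * M ^ 2)) := by
        rw [Finset.sum_mul]
    _ ≤ (r ^ 1 / (1 - r)) * ((K * t) ^ 2 * ((1 / 2 : ℝ) * M ^ 2)) :=
        mul_le_mul_of_nonneg_right hgeom hE
    _ = (K * t) ^ 2 * (r / (1 - r)) * ((1 / 2 : ℝ) * M ^ 2) := by rw [pow_one]; ring

end Summit.NavierStokesRegularity.NavierStokesRegularity.Theorems.KPChainLightCone

end
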